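import Literature.Analysis.FluidPDE.FluidComputer.HelicityBalance
import Literature.Analysis.FluidPDE.FluidComputer.TaylorGreenCurvature

/-!
# Beltrami fields are exact solutions of EVERY Galerkin truncation: the truncated Lamb vector of a self-curl field vanishes; the ABC flow decays as `e^{-νt}` on any mode set containing its six modes

HONEST FRAMING (cell `pub-fluidc`, verbatim): *low prior, high value-of-information experiment on
Tao's machine paradigm; NOT a claim that NS blows up.* The object is again the finite Galerkin system
(`IsGalerkinSolution`), i.e. what the cell's dealiased pseudo-spectral engines step (`Dealiasing`,
`RotationalForm`); no statement about the Navier–Stokes PDE is made.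

`ABCFlowData` proved POINTWISE that the ABC flow [cite: Frisch1995Turbulence, eq. (9.4)] is Beltrami
(`∇ × u = u`), that `(u·∇)u = ∇(|u|²/2)` and that `e^{-νt} u` solves Navier–Stokes with pressure
`-e^{-2νt}|u|²/2`; `ClassicalLatticeSpectra` v2 typed the datum as a `FourierVelocity` (`ABCHat.abc`)
with `curl û = û` coefficientwise (`curl_abc_coeff`). Here the corresponding statement is proved for the
TRUNCATED system — for every finite mode set at once and WITHOUT any triad computation: for a
self-curl coefficient field `V` (`curl V = V`) supported in `S`,

* `rotational_eq_zero_of_curl_eq_self` — the truncated Lamb vector `Σ_{q∈S} V̂(k-q) × ω̂(q)` vanishes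
  (`ω̂ = V̂` and the cross product is antisymmetric under the involution `q ↦ k - q` of the supported
  triads) — the Fourier-space form of `u × ω = u × u = 0`;
* `advection_eq_grad_of_curl_eq_self`, `leray_advection_eq_zero_of_curl_eq_self` — hence the Galerkin
  advection term is a pure gradient, `N_S(k) = -G(k) k` (`RotationalForm.rotational_eq`), and its Leray
  projection vanishes: a Beltrami field is a steady state of every truncated EULER system containing its
  support (the typed counterpart of dns-A's self-test "ABC flow is an Euler steady state,
  `|P[u × ω]|_max ≈ 1e-13`", HOME/code/dnsA/dnsa.py);
* `beltramiDecay_isGalerkinSolution` — with viscosity, `t ↦ e^{-νt} V` (unit shell `|k|² = 1`) solves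
  the unforced Galerkin system on `S` EXACTLY, for all `t ∈ ℝ`, with the pressure multiplier
  `c(t,k) = -G_t(k)` (nonzero: the Bernoulli pressure), and stays supported in `S`;
* the ABC instance (`abcDecay p ν`): `abcDecay_isGalerkinSolution` on every `S ⊇ ABCHat.modes`,
  `truncEnergy_abcDecay` `E_S(t) = ½(A²+B²+C²)e^{-2νt}`, `truncHelicity_abcDecay`
  `H_S(t) = (A²+B²+C²)e^{-2νt}` — consistent with the energy equation (`dE_S/dt = -2νZ_S`, `Z_S = E_S`)
  and with the helicity balance of `HelicityBalance` (`dH_S/dt = -2ν Σ|k|²H(k) = -2νH_S`), which are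
  thereby instantiated NON-VACUOUSLY on every such `S` (not only on a minimal truncation) with a genuine
  pressure term.

For the cell this is the typed content of HOME/LITERATURE.md §C10 (the CL-abc "precision probe": both
engines must keep the ABC run on the exact decay `e^{-2νt}` of `E`, `Z`, `H`; f64 does to `1e-12`, f32
drifts by `±1.5–3.5 × 10⁻⁴·E`): the reference curve is a theorem of the ODE system they integrate, at any
resolution. No named facts (D-0026).
-/

noncomputable section

namespace Literature.Analysis.FluidPDE.FluidComputer

open Complex ComplexConjugate Finset
open scoped BigOperators

namespace ShellTransfer

open TaylorGreenHat (scale scale_coeff advection_scale fourierVelocity_ext)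

/-! ## Self-curl fields have no truncated Lamb vector -/

/-- The cross product is antisymmetric. [folklore] -/
theorem ccross_anticomm (a b : Fin 3 → ℂ) (j : Fin 3) : ccross b a j = -ccross a b j := by
  fin_cases j <;> simp [ccross] <;> ring

/-- `a × a = 0`. [folklore] -/
theorem ccross_self (a : Fin 3 → ℂ) (j : Fin 3) : ccross a a j = 0 := by
  fin_cases j <;> simp [ccross] <;> ring

section SelfCurl

variable (V : FourierVelocity) (S : Finset (Fin 3 → ℤ))
  (hcurl : ∀ q j, (curl V).coeff q j = V.coeff q j) (hV : ∀ p ∉ S, V.coeff p = 0)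
include hcurl hV

/-- **A self-curl field has vanishing truncated Lamb vector**: if `curl V̂ = V̂` coefficientwise and `V̂`
is supported in `S`, then `Σ_{q∈S} V̂(k-q) × ω̂(q) = 0` for every `k` (pair `q` with `k - q`).
[folklore] -/
theorem rotational_eq_zero_of_curl_eq_self (k : Fin 3 → ℤ) : rotational V S k = 0 := by
  funext j
  unfold rotational
  have hω : ∀ q, (curl V).coeff q = V.coeff q := fun q => funext fun i => hcurl q i
  simp_rw [hω]
  -- restrict to the supported triads
  set T := S.filter (fun q => k - q ∈ S) with hT
  have hrestrict : ∑ q ∈ S, ccross (V.coeff (k - q)) (V.coeff q) j =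
      ∑ q ∈ T, ccross (V.coeff (k - q)) (V.coeff q) j := by
    rw [hT, Finset.sum_filter]
    refine Finset.sum_congr rfl fun q _ => ?_
    split_ifs with h
    · rfl
    · rw [hV (k - q) h]
      fin_cases j <;> simp [ccross]
  rw [show (0 : Fin 3 → ℂ) j = 0 from rfl, hrestrict]
  refine Finset.sum_involution (fun q _ => k - q) ?_ ?_ ?_ ?_
  · intro q _
    rw [sub_sub_cancel, ccross_anticomm (V.coeff (k - q)) (V.coeff q) j]
    ring
  · intro q _ hne heq
    apply hne
    have e : k - q = q := heq
    rw [e, ccross_self]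
  · intro q hq
    rw [hT, Finset.mem_filter] at hq ⊢
    refine ⟨hq.2, ?_⟩
    rw [sub_sub_cancel]
    exact hq.1
  · intro q _
    exact sub_sub_cancel k q

/-- Hence **the Galerkin advection term of a self-curl field is a pure gradient**:
`N_S(k)_j = -G(k) k_j`, `G` the Bernoulli scalar of `RotationalForm`. [folklore] -/
theorem advection_eq_grad_of_curl_eq_self (k : Fin 3 → ℤ) (j : Fin 3) :
    advection V S k j = -gradPart V S k * ((k j : ℤ) : ℂ) := by
  have h := rotational_eq V S hV k j
  rw [rotational_eq_zero_of_curl_eq_self V S hcurl hV k] at h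
  have h' : advection V S k j = (0 : Fin 3 → ℂ) j - gradPart V S k * ((k j : ℤ) : ℂ) := by
    rw [h]; ring
  rw [h']
  simp

/-- and **its Leray projection vanishes**: a self-curl field is a steady state of every truncated Euler
system containing its support (dns-A's ABC self-test, typed). [folklore] -/
theorem leray_advection_eq_zero_of_curl_eq_self (k : Fin 3 → ℤ) : leray k (advection V S k) = 0 := by
  have e : advection V S k = fun j => (-gradPart V S k) * ((k j : ℤ) : ℂ) :=
    funext fun j => by rw [advection_eq_grad_of_curl_eq_self V S hcurl hV k j]
  rw [e, leray_smul_self]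

end SelfCurl

/-! ## The decaying Beltrami mode is an exact Galerkin solution -/

/-- `k × (c a) = c (k × a)`. [folklore] -/
theorem kcross_const_mul (k : Fin 3 → ℤ) (c : ℂ) (a : Fin 3 → ℂ) (j : Fin 3) :
    kcross k (fun i => c * a i) j = c * kcross k a j := by
  fin_cases j <;> simp [kcross] <;> ring

/-- Scaling preserves the self-curl property. [folklore] -/
theorem curl_scale_coeff (r : ℝ) (V : FourierVelocity) (hcurl : ∀ q j, (curl V).coeff q j = V.coeff q j)
    (q : Fin 3 → ℤ) (j : Fin 3) : (curl (scale r V)).coeff q j = (scale r V).coeff q j := by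
  rw [curl_coeff, scale_coeff, ← hcurl q j, curl_coeff]
  have e : (scale r V).coeff q = fun i => (r : ℂ) * V.coeff q i := funext fun i => scale_coeff r V q i
  rw [e, kcross_const_mul]
  ring

/-- Scaling preserves the support. [folklore] -/
theorem scale_coeff_eq_zero {S : Finset (Fin 3 → ℤ)} (r : ℝ) (V : FourierVelocity)
    (hV : ∀ p ∉ S, V.coeff p = 0) (p : Fin 3 → ℤ) (hp : p ∉ S) : (scale r V).coeff p = 0 := by
  funext j
  rw [scale_coeff, hV p hp]
  simp

/-- **The decaying Beltrami mode** `t ↦ e^{-νt} V̂`. [folklore] -/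
def beltramiDecay (V : FourierVelocity) (ν t : ℝ) : FourierVelocity := scale (Real.exp (-ν * t)) V

/-- `beltramiDecay V ν 0 = V`. [folklore] -/
theorem beltramiDecay_zero (V : FourierVelocity) (ν : ℝ) : beltramiDecay V ν 0 = V := by
  refine fourierVelocity_ext ?_
  funext k j
  show ((Real.exp (-ν * 0) : ℝ) : ℂ) * V.coeff k j = V.coeff k j
  simp

/-- It stays supported where `V` is. [folklore] -/
theorem beltramiDecay_isSupportedOn {V : FourierVelocity} {S : Finset (Fin 3 → ℤ)}
    (hV : ∀ p ∉ S, V.coeff p = 0) (ν : ℝ) : IsSupportedOn (beltramiDecay V ν) S :=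
  fun t p hp => scale_coeff_eq_zero (Real.exp (-ν * t)) V hV p hp

/-- **The decaying Beltrami mode solves the unforced Galerkin system EXACTLY**, on every finite mode set
containing the support, for every viscosity and all `t ∈ ℝ`, with the (Bernoulli) pressure multiplier
`c(t,k) = -G_t(k)`: for a self-curl field on the unit shell the advection term is the gradient `-G k`,
which the pressure cancels, and what is left is `dû/dt = -ν|k|²û = -νû`. [folklore] -/
theorem beltramiDecay_isGalerkinSolution (V : FourierVelocity) (S : Finset (Fin 3 → ℤ))
    (hcurl : ∀ q j, (curl V).coeff q j = V.coeff q j) (h1 : IsSingleShell V 1)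
    (hV : ∀ p ∉ S, V.coeff p = 0) (ν : ℝ) :
    IsGalerkinSolution (beltramiDecay V ν) S ν
      (fun t k => -gradPart (beltramiDecay V ν t) S k) (fun _ _ _ => 0) := by
  intro t k _ j
  -- the right-hand side collapses to `-ν û_j(k,t)`
  have hadv : advection (beltramiDecay V ν t) S k j =
      -gradPart (beltramiDecay V ν t) S k * ((k j : ℤ) : ℂ) :=
    advection_eq_grad_of_curl_eq_self _ S (curl_scale_coeff _ V hcurl) (scale_coeff_eq_zero _ V hV) k j
  have hshell : (knormSq k : ℂ) * V.coeff k j = V.coeff k j := by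
    by_cases hz : V.coeff k = 0
    · rw [hz]; simp
    · rw [h1 k hz]; simp
  have hrhs : galerkinRHS (beltramiDecay V ν t) S ν ((fun t k => -gradPart (beltramiDecay V ν t) S k) t)
      ((fun _ _ _ => (0 : ℂ)) t) k j = ((-ν * Real.exp (-ν * t) : ℝ) : ℂ) * V.coeff k j := by
    unfold galerkinRHS
    rw [hadv]
    show -(ν : ℂ) * (knormSq k : ℂ) * (((Real.exp (-ν * t) : ℝ) : ℂ) * V.coeff k j) +
        (-gradPart (beltramiDecay V ν t) S k * ((k j : ℤ) : ℂ) -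
          -gradPart (beltramiDecay V ν t) S k * ((k j : ℤ) : ℂ)) + 0 = _
    rw [sub_self, add_zero, add_zero]
    calc -(ν : ℂ) * (knormSq k : ℂ) * (((Real.exp (-ν * t) : ℝ) : ℂ) * V.coeff k j)
        = -(ν : ℂ) * ((Real.exp (-ν * t) : ℝ) : ℂ) * ((knormSq k : ℂ) * V.coeff k j) := by ring
      _ = ((-ν * Real.exp (-ν * t) : ℝ) : ℂ) * V.coeff k j := by rw [hshell]; push_cast; ring
  rw [hrhs]
  have hfun : (fun s => (beltramiDecay V ν s).coeff k j) =
      fun s => ((Real.exp (-ν * s) : ℝ) : ℂ) * V.coeff k j := by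
    funext s; rfl
  rw [hfun]
  have hd := ((((hasDerivAt_id' t).const_mul (-ν)).exp).ofReal_comp).mul_const (V.coeff k j)
  refine hd.congr_deriv ?_
  push_cast
  ring

/-- Its energy: `E_S(t) = e^{-2νt} E_S(V)`. [folklore] -/
theorem truncEnergy_beltramiDecay (V : FourierVelocity) (S : Finset (Fin 3 → ℤ)) (ν t : ℝ) :
    truncEnergy (beltramiDecay V ν t) S = Real.exp (-(2 * ν) * t) * truncEnergy V S := by
  have hE : ∀ k, modalEnergy (beltramiDecay V ν t) k = Real.exp (-ν * t) ^ 2 * modalEnergy V k := by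
    intro k
    unfold modalEnergy
    simp only [beltramiDecay, scale_coeff, Complex.normSq_mul, Complex.normSq_ofReal]
    rw [Finset.mul_sum, Finset.mul_sum, Finset.mul_sum]
    refine Finset.sum_congr rfl fun j _ => ?_
    ring
  unfold truncEnergy
  simp_rw [hE]
  rw [← Finset.mul_sum, sq, ← Real.exp_add]
  ring_nf

/-- Its helicity: `H_S(t) = e^{-2νt} H_S(V)`. [folklore] -/
theorem truncHelicity_beltramiDecay (V : FourierVelocity) (S : Finset (Fin 3 → ℤ)) (ν t : ℝ) :
    truncHelicity (beltramiDecay V ν t) S = Real.exp (-(2 * ν) * t) * truncHelicity V S := by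
  have hH : ∀ k, modalHelicity (beltramiDecay V ν t) k = Real.exp (-ν * t) ^ 2 * modalHelicity V k := by
    intro k
    rw [modalHelicity_eq_curlPair, modalHelicity_eq_curlPair]
    unfold curlPair
    have e : (beltramiDecay V ν t).coeff k = fun i => ((Real.exp (-ν * t) : ℝ) : ℂ) * V.coeff k i :=
      funext fun i => scale_coeff _ V k i
    rw [e]
    simp_rw [kcross_const_mul]
    have e2 : ∑ j, ((Real.exp (-ν * t) : ℝ) : ℂ) * V.coeff k j *
        conj (I * (((Real.exp (-ν * t) : ℝ) : ℂ) * kcross k (V.coeff k) j)) =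
        (((Real.exp (-ν * t) ^ 2 : ℝ)) : ℂ) * ∑ j, V.coeff k j * conj (I * kcross k (V.coeff k) j) := by
      rw [Finset.mul_sum]
      refine Finset.sum_congr rfl fun j _ => ?_
      simp only [map_mul, Complex.conj_ofReal]
      push_cast
      ring
    rw [e2, Complex.re_ofReal_mul]
  unfold truncHelicity
  simp_rw [hH]
  rw [← Finset.mul_sum, sq, ← Real.exp_add]
  ring_nf

/-! ## The ABC flow -/

namespace ABCHat

open ABCFlow

variable (p : Coeffs)

/-- The ABC coefficients vanish off the six modes. [folklore] -/
theorem abc_coeff_of_not_mem {k : Fin 3 → ℤ} (hk : k ∉ modes) : (abc p).coeff k = 0 :=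
  funext fun j => coeffFun_off p (offModes_of_not_mem hk) j

/-- **The decaying ABC flow** `û(k,t) = e^{-νt} û_ABC(k)` (`ABCFlowData`'s `U, V, W` in Fourier space).
[cite: Frisch1995Turbulence, eq. (9.4)] -/
def abcDecay (ν t : ℝ) : FourierVelocity := beltramiDecay (abc p) ν t

/-- **The decaying ABC flow solves the unforced Galerkin system exactly on EVERY mode set containing its
six modes**, for every viscosity (`ν = 0`: a steady state of every such truncated Euler system), with the
Bernoulli pressure multiplier. [folklore] -/
theorem abcDecay_isGalerkinSolution {S : Finset (Fin 3 → ℤ)} (hS : modes ⊆ S) (ν : ℝ) :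
    IsGalerkinSolution (abcDecay p ν) S ν (fun t k => -gradPart (abcDecay p ν t) S k) (fun _ _ _ => 0) :=
  beltramiDecay_isGalerkinSolution (abc p) S (curl_abc_coeff p) (abc_isSingleShell p)
    (fun _ hq => abc_coeff_of_not_mem p fun h => hq (hS h)) ν

/-- It is supported in any such `S`. [folklore] -/
theorem abcDecay_isSupportedOn {S : Finset (Fin 3 → ℤ)} (hS : modes ⊆ S) (ν : ℝ) :
    IsSupportedOn (abcDecay p ν) S :=
  beltramiDecay_isSupportedOn (fun _ hq => abc_coeff_of_not_mem p fun h => hq (hS h)) ν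

/-- `abcDecay p ν 0 = abc p`. [folklore] -/
theorem abcDecay_zero (ν : ℝ) : abcDecay p ν 0 = abc p := beltramiDecay_zero (abc p) ν

/-- **The ABC flow is a steady state of every truncated Euler system containing its modes** — the
Leray-projected Galerkin advection term vanishes identically (cf. dns-A's self-test
`|P[u × ω]|_max ≈ 1e-13`). [folklore] -/
theorem leray_advection_abc_eq_zero {S : Finset (Fin 3 → ℤ)} (hS : modes ⊆ S) (k : Fin 3 → ℤ) :
    leray k (advection (abc p) S k) = 0 :=
  leray_advection_eq_zero_of_curl_eq_self (abc p) S (curl_abc_coeff p)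
    (fun _ hq => abc_coeff_of_not_mem p fun h => hq (hS h)) k

/-- Energy off the six modes does not count: `E_S(abc) = E_modes(abc)`. [folklore] -/
theorem truncEnergy_abc_of_subset {S : Finset (Fin 3 → ℤ)} (hS : modes ⊆ S) :
    truncEnergy (abc p) S = (p.A ^ 2 + p.B ^ 2 + p.C ^ 2) / 2 := by
  rw [← truncEnergy_abc p]
  unfold truncEnergy
  symm
  refine Finset.sum_subset hS fun k _ hk => ?_
  exact modalEnergy_eq_zero_of_coeff (abc p) (abc_coeff_of_not_mem p hk)

/-- Helicity likewise: `H_S(abc) = A² + B² + C²` on any `S ⊇ modes`. [folklore] -/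
theorem truncHelicity_abc_of_subset {S : Finset (Fin 3 → ℤ)} (hS : modes ⊆ S) :
    truncHelicity (abc p) S = p.A ^ 2 + p.B ^ 2 + p.C ^ 2 := by
  rw [← truncHelicity_abc p]
  unfold truncHelicity
  symm
  refine Finset.sum_subset hS fun k _ hk => ?_
  rw [modalHelicity_abc, modalEnergy_eq_zero_of_coeff (abc p) (abc_coeff_of_not_mem p hk), mul_zero]

/-- **`E_S(t) = ½(A²+B²+C²) e^{-2νt}`** along the decaying ABC flow, on any `S ⊇ modes` — the CL-abc
reference curve of the cell's precision probe. [folklore] -/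
theorem truncEnergy_abcDecay {S : Finset (Fin 3 → ℤ)} (hS : modes ⊆ S) (ν t : ℝ) :
    truncEnergy (abcDecay p ν t) S = (p.A ^ 2 + p.B ^ 2 + p.C ^ 2) / 2 * Real.exp (-(2 * ν) * t) := by
  unfold abcDecay
  rw [truncEnergy_beltramiDecay, truncEnergy_abc_of_subset p hS]
  ring

/-- **`H_S(t) = (A²+B²+C²) e^{-2νt}`** — the helicity of the decaying ABC flow (maximal: `H_S = 2E_S`
throughout), consistent with `HelicityBalance.hasDerivAt_truncHelicity_unforced` (`|k|² = 1`). [folklore] -/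
theorem truncHelicity_abcDecay {S : Finset (Fin 3 → ℤ)} (hS : modes ⊆ S) (ν t : ℝ) :
    truncHelicity (abcDecay p ν t) S = (p.A ^ 2 + p.B ^ 2 + p.C ^ 2) * Real.exp (-(2 * ν) * t) := by
  unfold abcDecay
  rw [truncHelicity_beltramiDecay, truncHelicity_abc_of_subset p hS]
  ring

/-- Cross-check with the helicity balance: `HelicityBalance.hasDerivAt_truncHelicity_unforced` applied to
the decaying ABC flow (a supported Galerkin solution on the symmetric set `S`) gives
`dH_S/dt = -2ν Σ_{k∈S} |k|² H(k)`; here that is `-2ν H_S(t)` (unit shell), the derivative of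
`(A²+B²+C²) e^{-2νt}`. [folklore] -/
theorem hasDerivAt_truncHelicity_abcDecay {S : Finset (Fin 3 → ℤ)} (hS : modes ⊆ S)
    (hsym : ∀ k ∈ S, -k ∈ S) (ν t : ℝ) :
    HasDerivAt (fun s => truncHelicity (abcDecay p ν s) S)
      (-(2 * ν) * helicityDissipation (abcDecay p ν t) S) t :=
  hasDerivAt_truncHelicity_unforced (abcDecay_isGalerkinSolution p hS ν) hsym (abcDecay_isSupportedOn p hS ν) t

end ABCHat

end ShellTransfer

end Literature.Analysis.FluidPDE.FluidComputer

end
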